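import Literature.MathematicalPhysics.QuantumFieldTheory.LatticeLangevinDynamics
import Literature.MathematicalPhysics.QuantumLattice.RepLieAlgebraUnitary
import Summits.QuantumFields.YangMills.Theorems.FradkinShenkerFlowFiniteSusceptibilityWeakCouplingSU2ConjugationEven
import HarnessLib

/-!
# Route `ColdStartUniversality`, support item S (stmt-QuantumFields-24811), line `piwiener`:
# the quaternion plane — the real span of `SU(2)` meets the Frobenius sphere `‖Q‖_F² = 2` exactly in `SU(2)`

Helper file (lead `ym-line-csu-p1`) for the registered stub `stub_coldStartStrongExistence`.  The
existence proof solves a globally Lipschitz modification of the SZZ system in the ambient space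
`M₂(ℂ)^E`; the solution stays in the real span `V = span_ℝ SU(2)` of the group (the coefficients map
`V^E` into `V`, sibling file `…SpanRange`) and keeps `‖Q_e‖_F² = 2` (tangency identities + Itô's product
rule).  This file is the `SU(2)`-specific identification that turns those two invariants into
`Q_e ∈ SU(2)`:

* `apply_one_one_eq`, `apply_one_zero_eq` — an `SU(2)` matrix is `[[z, w], [−w̄, z̄]]`
  (`Aᴴ = A⁻¹ = adj A` since `det A = 1`: the tree's `SU2ConjugationEven.star_eq_adjugate`);
* `span_fundamentalRep_le_quaternion` — hence every `M ∈ span_ℝ SU(2)` has the quaternion form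
  `M 1 1 = conj (M 0 0)`, `M 1 0 = −conj (M 0 1)` (the real 4-plane `ℍ ⊂ M₂(ℂ)`);
* `mem_range_fundamentalRep_of_mem_span` — **a quaternion `M` with `‖M‖_F² = Σ|M i j|² = 2` (tree
  `hsForm 2 M M = 2`) is in `SU(2)`**: `M Mᴴ = (|z|² + |w|²) 1 = 1` and `det M = |z|² + |w|² = 1`;
* `hsForm_self_of_mem_unitaryGroup` — conversely `‖ρ(g)‖_F² = N` for unitary matrices (so the cold
  start `Q ≡ 1` and every `SU(2)`-valued configuration lie on the sphere).

(For `SU(N)`, `N ≥ 3`, `span_ℝ SU(N) = M_N(ℂ)` and the sphere is NOT the group — the quaternion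
coincidence is special to `N = 2`, which is the group of the route.)  No definition, no sorry, standard
axioms.  RECORD-rung plumbing; nothing here bears on the mass gap.
-/

set_option autoImplicit false

noncomputable section

namespace Summit.QuantumFields.YangMills.Theorems.ColdStartUniversality

open Matrix Complex Finset
open scoped ComplexConjugate BigOperators
open Literature.MathematicalPhysics.QuantumFieldTheory
open Literature.MathematicalPhysics.QuantumLattice (fundamentalRep)

/-! ### `SU(2)` matrices are quaternions -/

/-- An `SU(2)` matrix `[[z, w], [u, v]]` has `v = conj z`. [folklore] -/
theorem apply_one_one_eq {A : Matrix (Fin 2) (Fin 2) ℂ}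
    (hA : A ∈ Matrix.specialUnitaryGroup (Fin 2) ℂ) : A 1 1 = conj (A 0 0) := by
  have h := congrFun (congrFun (FiniteSusceptibilityWeakCoupling.SU2ConjugationEven.star_eq_adjugate hA) 0) 0
  rw [Matrix.star_apply, Matrix.adjugate_fin_two] at h
  simp only [Matrix.of_apply, Matrix.cons_val', Matrix.cons_val_zero, Matrix.cons_val_fin_one] at h
  exact h.symm

/-- An `SU(2)` matrix `[[z, w], [u, v]]` has `u = −conj w`. [folklore] -/
theorem apply_one_zero_eq {A : Matrix (Fin 2) (Fin 2) ℂ}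
    (hA : A ∈ Matrix.specialUnitaryGroup (Fin 2) ℂ) : A 1 0 = -conj (A 0 1) := by
  have h := congrFun (congrFun (FiniteSusceptibilityWeakCoupling.SU2ConjugationEven.star_eq_adjugate hA) 1) 0
  rw [Matrix.star_apply, Matrix.adjugate_fin_two] at h
  simp only [Matrix.of_apply, Matrix.cons_val', Matrix.cons_val_zero, Matrix.cons_val_one,
    Matrix.cons_val_fin_one] at h
  have h' : conj (A 0 1) = -A 1 0 := h
  rw [h', neg_neg]

/-- **`span_ℝ SU(2) ⊆ ℍ`**: every real linear combination of `SU(2)` matrices (the real span of the range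
of the fundamental representation) has the quaternion form `M 1 1 = conj (M 0 0)`,
`M 1 0 = −conj (M 0 1)`. [folklore] -/
theorem span_fundamentalRep_le_quaternion {M : Matrix (Fin 2) (Fin 2) ℂ}
    (hM : M ∈ Submodule.span ℝ (Set.range (fundamentalRep (Fin 2)))) :
    M 1 1 = conj (M 0 0) ∧ M 1 0 = -conj (M 0 1) := by
  induction hM using Submodule.span_induction with
  | mem x hx =>
    obtain ⟨g, rfl⟩ := hx
    exact ⟨apply_one_one_eq g.2, apply_one_zero_eq g.2⟩
  | zero => simp
  | add x y _ _ hx hy =>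
    refine ⟨?_, ?_⟩
    · simp [Matrix.add_apply, hx.1, hy.1]
    · simp [Matrix.add_apply, hx.2, hy.2]; ring
  | smul c x _ hx =>
    refine ⟨?_, ?_⟩
    · simp [Matrix.smul_apply, hx.1, Complex.real_smul]
    · simp [Matrix.smul_apply, hx.2, Complex.real_smul]

/-! ### The sphere in the quaternion plane is the group -/

/-- `Σᵢⱼ |M i j|²` of a quaternion `[[z, w], [−w̄, z̄]]` is `2(|z|² + |w|²)`. [folklore] -/
theorem hsForm_self_quaternion {M : Matrix (Fin 2) (Fin 2) ℂ} (h11 : M 1 1 = conj (M 0 0))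
    (h10 : M 1 0 = -conj (M 0 1)) :
    hsForm 2 M M = 2 * (‖M 0 0‖ ^ 2 + ‖M 0 1‖ ^ 2) := by
  rw [hsForm_self]
  simp [Fin.sum_univ_two, h11, h10]
  ring

/-- **A quaternion on the Frobenius sphere `‖M‖_F² = 2` is special unitary.**  For
`M = [[z, w], [−w̄, z̄]]` with `|z|² + |w|² = 1`: `M Mᴴ = 1` and `det M = 1`. [folklore] -/
theorem mem_specialUnitaryGroup_of_quaternion {M : Matrix (Fin 2) (Fin 2) ℂ}
    (h11 : M 1 1 = conj (M 0 0)) (h10 : M 1 0 = -conj (M 0 1)) (h2 : hsForm 2 M M = 2) :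
    M ∈ Matrix.specialUnitaryGroup (Fin 2) ℂ := by
  have hn : ‖M 0 0‖ ^ 2 + ‖M 0 1‖ ^ 2 = 1 := by
    have h := hsForm_self_quaternion h11 h10
    rw [h2] at h
    linarith
  have hnC : M 0 0 * conj (M 0 0) + M 0 1 * conj (M 0 1) = 1 := by
    rw [Complex.mul_conj, Complex.mul_conj, ← Complex.ofReal_add, Complex.normSq_eq_norm_sq,
      Complex.normSq_eq_norm_sq, hn, Complex.ofReal_one]
  obtain ⟨z, w, hzw⟩ : ∃ z w : ℂ, M = !![z, w; -conj w, conj z] :=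
    ⟨M 0 0, M 0 1, by rw [← h10, ← h11]; exact Matrix.eta_fin_two M⟩
  subst hzw
  simp only [Matrix.of_apply, Matrix.cons_val', Matrix.cons_val_zero, Matrix.cons_val_one,
    Matrix.cons_val_fin_one] at hnC
  have hstar : star !![z, w; -conj w, conj z] = !![conj z, -w; conj w, z] := by
    ext i j
    fin_cases i <;> fin_cases j <;> simp [Matrix.star_apply]
  rw [Matrix.mem_specialUnitaryGroup_iff, Matrix.mem_unitaryGroup_iff, hstar, Matrix.mul_fin_two,
    Matrix.one_fin_two, Matrix.det_fin_two_of]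
  constructor
  · ext i j
    fin_cases i <;> fin_cases j
    · simpa using hnC
    · simp; ring
    · simp; ring
    · simp; linear_combination hnC
  · linear_combination hnC

/-- **`span_ℝ SU(2) ∩ {‖M‖_F² = 2} ⊆ SU(2)`**, in the route's vocabulary: an `M` in the real span of the
range of the fundamental representation of `SU(2)` with `hsForm 2 M M = 2` IS in that range. -/
theorem mem_range_fundamentalRep_of_mem_span {M : Matrix (Fin 2) (Fin 2) ℂ}
    (hM : M ∈ Submodule.span ℝ (Set.range (fundamentalRep (Fin 2))))
    (h2 : hsForm 2 M M = 2) : M ∈ Set.range (fundamentalRep (Fin 2)) := by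
  obtain ⟨h11, h10⟩ := span_fundamentalRep_le_quaternion hM
  exact ⟨⟨M, mem_specialUnitaryGroup_of_quaternion h11 h10 h2⟩, rfl⟩

/-! ### Unitary matrices lie on the sphere -/

/-- `‖A‖_F² = Re tr(A Aᴴ) = N` for a unitary `N × N` matrix. [folklore] -/
theorem hsForm_self_of_mem_unitaryGroup {N : ℕ} {A : Matrix (Fin N) (Fin N) ℂ}
    (hA : A ∈ Matrix.unitaryGroup (Fin N) ℂ) : hsForm N A A = N := by
  rw [hsForm_apply]
  change (A * star A).trace.re = _
  rw [Matrix.mem_unitaryGroup_iff.1 hA, Matrix.trace_one]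
  simp

/-- `‖ρ(g)‖_F² = N` for every lattice representation (unitary values). [folklore] -/
theorem hsForm_self_rho {G : Type*} [Group G] [TopologicalSpace G] (r : LatticeRep G) (g : G) :
    hsForm r.N (r.ρ g) (r.ρ g) = r.N :=
  hsForm_self_of_mem_unitaryGroup (r.mem_unitary g)

/-- In particular every `SU(2)`-valued configuration has all links on the sphere `‖Q_e‖_F² = 2`, and so
does the cold start `Q ≡ 1 = ρ(1)`. [folklore] -/
theorem hsForm_self_fundamentalRep (g : Matrix.specialUnitaryGroup (Fin 2) ℂ) :
    hsForm 2 (fundamentalRep (Fin 2) g) (fundamentalRep (Fin 2) g) = 2 := by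
  have h := hsForm_self_of_mem_unitaryGroup (N := 2)
    (Matrix.specialUnitaryGroup_le_unitaryGroup g.2)
  simpa using h

end Summit.QuantumFields.YangMills.Theorems.ColdStartUniversality

end
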